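import Literature.Analysis.FluidPDE.KwonHarmonicPart
import Literature.Analysis.FluidPDE.NewtonLocalPotential
import Literature.Analysis.FluidPDE.LocalHelmholtzSupBound
import HarnessLib

/-!
# Kwon's divergence-free test fields `ζ = −curl(φ curl (Γ ⋆ ξ))` (slice level)

Analysis/FluidPDE file on the discharge path of the named fact
`Literature.Analysis.FluidPDE.kwon2023_velocity_epsilon_regularity`
(`PressureFreeEpsilonRegularity.lean`; H. Kwon, J. Differential Equations (2023) =
arXiv:2104.03160, Thm. 1.4), second brick of Lemma 2.5 after `KwonHarmonicPart.lean`. The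
printed proof derives the equation of the principal part `v = ℙ_φ u` "rigorously by testing
(NS) with `−curl(φ curl Δ⁻¹ξ)` for any `ξ ∈ C_c^∞((−4,0) × B₁)`" (proof of Lemma 2.5, p. 8):
these fields are divergence free, so the pressure term `∬ p div ζ` drops out for ANY
distributional pressure (Remark 2.3: `ℙ_φ ∇p = 0`) — the whole pressure-free mechanism. This file
builds the fields at a fixed time and proves their pointwise structure:

* `Kwon2023.testKernel = newtonNear 3 4` (`L¹`, `= Γ` on `|z| ≤ 3`) and the vector potential
  `Kwon2023.testPotential ξ = N ⋆ ξ` of a test field `ξ ∈ C_c^∞(B₁; ℝ³)`: smooth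
  (`contDiff_testPotential`), componentwise the tree's `newtonNearPotential 3 4`
  (`testPotential_apply_coord`), and **`ΔA = ξ` on `B₂`** (`laplacian_testPotential`; Green's
  representation `laplacian_newtonNearPotential`, the smoothing remainder vanishing on `B₂`,
  `newtonFarSmoothing_eq_zero_of_tsupport`);
* `Kwon2023.testField ξ = −curl(φ • curl A)` with Kwon's cut-off `φ = Kwon2023.kwonCutoff`:
  smooth, supported in `B̄(0, 7/4)` (`tsupport_testField_subset`, `hasCompactSupport_testField`),
  **divergence free** (`divergence_testField`), and the expansion
  `ζ = φ ξ − φ ∇(div A) − ∇φ × curl A` (`testField_eq`; Leibniz for `curl`,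
  `curl curl = ∇ div − Δ`, `φ ΔA = φ ξ`);
* **kernel swap** near the annulus `5/4 ≤ |y| ≤ 7/4` carrying `∇φ`: for `supp ξ ⊆ B̄(0, r)`,
  `r < 1`, `A = k ⋆ ξ` near such `y` with the smooth annular kernel `k` of
  `KwonHarmonicPart.lean` (`testPotential_eventuallyEq`), hence `DA`, `div A`, `curl A` agree
  there with those of `k ⋆ ξ` (`fderiv_/divergence_/curl_testPotential_eq`) — no singular
  integral ever meets the densities `u·∇φ`, `∇φ × u`.

Deliberately NOT here (next file): the slice duality identity
`∫ ⟪u, ζ⟫ = ∫ ⟪u − h, ξ⟫` for weakly divergence-free `u ∈ L¹(B₂)` (`h = Kwon2023.harmonicPart u`),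
obtained from `testField_eq` by the weak divergence-free condition (the `∇(φ div A)` part) and
two Fubini/adjoint computations on the annulus; and the space–time version.

## Mathlib / tree search

Tree (reused): `newtonNear*`, `integrable_newtonNear`, `newtonNearPotential`,
`laplacian_newtonNearPotential`, `newtonFarSmoothing`, `newtonFarLaplacian_eq_zero_of_lt`
(`NewtonKernel`, `NewtonPotential`, `NewtonLocalPotential`); `curl_smul`,
`curl_eq_zero_of_notMem_tsupport`, `contDiff_curl` (`VorticityCalculus`);
`fderiv_eq_innerSL_gradient`, `inner_gradient_left` (`BiotSavartCurlPair`),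
`curlCLM_smulRight_innerSL` (`BiotSavartNewtonKernel`),
`curl_curl_eq_sum_fderiv_divergence_sub_laplacian` (`LocalHelmholtzSupBound`),
`divergence_curl_eq_zero_holds` (`VectorCalculusProofs`), `integrable_smul_comp_sub`
(`HarmonicProbe`), `Kwon2023.annularKernel*`, `Kwon2023.kwonCutoff` (`KwonHarmonicPart`).
Mathlib: `HasCompactSupport.contDiff_convolution_right`, `ContDiffAt.laplacian_CLM_comp_left`,
`PiLp.proj`, `PiLp.ext`, `contDiff_euclidean`, `OrthonormalBasis.sum_repr'`,
`Filter.EventuallyEq.fderiv_eq`. `lean search 'testField|testPotential|Kwon2023'`: only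
`KwonHarmonicPart`.

## References

* H. Kwon, J. Differential Equations (2023) = arXiv:2104.03160: Def. 2.1, Remark 2.3, proof of
  Lemma 2.5 (arXiv p. 8). [Kwon2023RolePressure]
* D. Gilbarg, N. S. Trudinger, *Elliptic partial differential equations of second order* (2001),
  (2.16)–(2.17). [GilbargTrudinger2001]
* A. J. Majda, A. L. Bertozzi, *Vorticity and incompressible flow*, CUP (2002), §2.4.1
  (`curl curl = ∇ div − Δ`). [MajdaBertozziCUP2002]
-/

noncomputable section

open MeasureTheory Set Function Filter Topology TopologicalSpace Metric InnerProductSpace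
  ContinuousLinearMap
open scoped NNReal ENNReal RealInnerProductSpace Convolution Laplacian ContDiff

namespace Literature.Analysis.FluidPDE

namespace Kwon2023

/-! ### The test-side kernel and the vector potential of a test field -/

/-- The **test-side Newtonian kernel** `N = θ_{3,4} Γ` (`newtonNear 3 4`): in `L¹`, supported in
`|z| ≤ 4`, equal to `Γ` on `|z| ≤ 3`. [folklore] -/
def testKernel : EuclideanSpace ℝ (Fin 3) → ℝ := newtonNear 3 4

/-- The test-side kernel is integrable. [folklore] -/
theorem integrable_testKernel : Integrable testKernel :=
  integrable_newtonNear (by norm_num) (by norm_num)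

/-- `N = Γ` on the closed ball of radius `3`. [folklore] -/
theorem testKernel_eq_newtonKernel {z : EuclideanSpace ℝ (Fin 3)} (hz : ‖z‖ ≤ 3) :
    testKernel z = newtonKernel z :=
  newtonNear_eq_newtonKernel (by norm_num) (by norm_num) hz

/-- `N = k` (the annular kernel) on the shell `1/4 ≤ |z| ≤ 3`. [folklore] -/
theorem testKernel_eq_annularKernel {z : EuclideanSpace ℝ (Fin 3)} (h₁ : 1 / 4 ≤ ‖z‖)
    (h₂ : ‖z‖ ≤ 3) : testKernel z = annularKernel z := by
  rw [testKernel_eq_newtonKernel h₂, annularKernel_eq_newtonKernel h₁ h₂]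

variable {ξ : EuclideanSpace ℝ (Fin 3) → EuclideanSpace ℝ (Fin 3)}

variable (ξ) in
/-- The **vector Newtonian potential** `A = N ⋆ ξ` of a test field (componentwise the tree's
`newtonNearPotential 3 4`). [folklore] -/
def testPotential : EuclideanSpace ℝ (Fin 3) → EuclideanSpace ℝ (Fin 3) :=
  testKernel ⋆[lsmul ℝ ℝ, volume] ξ

/-- **`A` is smooth** for a smooth compactly supported `ξ`. [folklore] -/
theorem contDiff_testPotential (hξ : ContDiff ℝ ∞ ξ) (hξc : HasCompactSupport ξ) {n : ℕ∞} :
    ContDiff ℝ n (testPotential ξ) :=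
  hξc.contDiff_convolution_right _ integrable_testKernel.locallyIntegrable (hξ.of_le (by simp))

/-- The components of `A` are the scalar truncated Newtonian potentials of the components of
`ξ`. [folklore] -/
theorem testPotential_apply_coord (hξ : ContDiff ℝ ∞ ξ) (x : EuclideanSpace ℝ (Fin 3)) (i : Fin 3) :
    testPotential ξ x i = newtonNearPotential 3 4 (fun y => ξ y i) x := by
  rw [testPotential, convolution_lsmul, newtonNearPotential_apply]
  have hint : Integrable fun z => testKernel z • ξ (x - z) :=
    integrable_smul_comp_sub integrable_testKernel
      (fun z hz => newtonNear_eq_zero (by norm_num) (by norm_num) hz.le) hξ.continuous x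
  have h := ((PiLp.proj 2 (fun _ : Fin 3 => ℝ) i).integral_comp_comm (𝕜 := ℝ) hint).symm
  refine h.trans (integral_congr_ae (Eventually.of_forall fun z => ?_))
  simp [PiLp.proj_apply, testKernel]

/-- The smoothing remainder `Λ[g]` of a function supported in `B₁` vanishes on `B₂` (its
kernel lives in `3 ≤ |z| ≤ 4`). [folklore] -/
theorem newtonFarSmoothing_eq_zero_of_tsupport {g : EuclideanSpace ℝ (Fin 3) → ℝ}
    (hg : tsupport g ⊆ ball (0 : EuclideanSpace ℝ (Fin 3)) 1) {x : EuclideanSpace ℝ (Fin 3)}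
    (hx : ‖x‖ < 2) : newtonFarSmoothing 3 4 g x = 0 := by
  rw [newtonFarSmoothing_apply]
  refine integral_eq_zero_of_ae (Eventually.of_forall fun z => ?_)
  simp only [Pi.zero_apply]
  by_cases hz : ‖z‖ < 3
  · rw [newtonFarLaplacian_eq_zero_of_lt (by norm_num) (by norm_num) hz, zero_mul]
  · have hxz : x - z ∉ tsupport g := by
      intro hmem
      have h1 : ‖x - z‖ < 1 := mem_ball_zero_iff.1 (hg hmem)
      have h2 : ‖z‖ ≤ ‖x‖ + ‖x - z‖ := by
        have := norm_sub_le x (x - z); rwa [sub_sub_cancel] at this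
      push Not at hz
      linarith
    rw [image_eq_zero_of_notMem_tsupport hxz, mul_zero]

/-- **`ΔA = ξ` on `B₂`** for a test field supported in `B₁` (Green's representation with the
truncated kernel, `laplacian_newtonNearPotential`, componentwise; the smoothing remainder
vanishes on `B₂`). [cite: GilbargTrudinger2001, (2.17)] -/
theorem laplacian_testPotential (hξ : ContDiff ℝ ∞ ξ) (hξc : HasCompactSupport ξ)
    (hsupp : tsupport ξ ⊆ ball (0 : EuclideanSpace ℝ (Fin 3)) 1) {x : EuclideanSpace ℝ (Fin 3)}
    (hx : ‖x‖ < 2) : (Δ (testPotential ξ)) x = ξ x := by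
  have hA : ContDiff ℝ 2 (testPotential ξ) := contDiff_testPotential hξ hξc
  refine PiLp.ext fun i => ?_
  have hcomp : (Δ (testPotential ξ)) x i = (Δ (fun y => testPotential ξ y i)) x := by
    have h := (hA.contDiffAt (x := x)).laplacian_CLM_comp_left
      (l := PiLp.proj 2 (fun _ : Fin 3 => ℝ) i)
    exact h.symm
  have hfun : (fun y => testPotential ξ y i) = newtonNearPotential 3 4 (fun y => ξ y i) :=
    funext fun y => testPotential_apply_coord hξ y i
  have hξ2 : ContDiff ℝ 2 ξ := contDiff_infty.1 hξ 2
  have hξi : ContDiff ℝ 2 fun y => ξ y i := contDiff_euclidean.1 hξ2 i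
  have hsuppi : tsupport (fun y => ξ y i) ⊆ ball (0 : EuclideanSpace ℝ (Fin 3)) 1 :=
    (tsupport_comp_subset (g := fun v : EuclideanSpace ℝ (Fin 3) => v i) rfl ξ).trans hsupp
  rw [hcomp, hfun, laplacian_newtonNearPotential (by norm_num) (by norm_num) hξi x,
    newtonFarSmoothing_eq_zero_of_tsupport hsuppi hx, sub_zero]

/-! ### Kwon's test field `ζ = −curl (φ curl A)` -/

variable (ξ) in
/-- **Kwon's divergence-free test field** `ζ = −curl(φ curl A)`, `A = N ⋆ ξ` (Kwon 2023, proof of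
Lemma 2.5: "This can be done rigorously by testing (NS) with `−curl(φ curl Δ⁻¹ξ)` for any
`ξ ∈ C_c^∞((−4,0) × B₁)`"; slice level). [cite: Kwon2023RolePressure, Lemma 2.5 (proof, p. 8)] -/
def testField (x : EuclideanSpace ℝ (Fin 3)) : EuclideanSpace ℝ (Fin 3) :=
  -curl (fun y => kwonCutoff y • curl (testPotential ξ) y) x

/-- The field `φ curl A` is smooth. [folklore] -/
theorem contDiff_smul_curl_testPotential (hξ : ContDiff ℝ ∞ ξ) (hξc : HasCompactSupport ξ)
    {n : ℕ∞} : ContDiff ℝ n fun y => kwonCutoff y • curl (testPotential ξ) y :=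
  contDiff_kwonCutoff.smul (contDiff_curl (contDiff_testPotential hξ hξc))

/-- The field `φ curl A` vanishes off `|y| < 7/4`. [folklore] -/
theorem smul_curl_testPotential_eq_zero {y : EuclideanSpace ℝ (Fin 3)} (hy : 7 / 4 ≤ ‖y‖) :
    kwonCutoff y • curl (testPotential ξ) y = 0 := by
  rw [kwonCutoff, radialCutoff_eq_zero (by norm_num) (by norm_num) hy, zero_smul]

/-- The field `φ curl A` has topological support in `B̄(0, 7/4)`. [folklore] -/
theorem tsupport_smul_curl_testPotential_subset :
    tsupport (fun y => kwonCutoff y • curl (testPotential ξ) y) ⊆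
      closedBall (0 : EuclideanSpace ℝ (Fin 3)) (7 / 4) := by
  refine closure_minimal (fun y hy => ?_) isClosed_closedBall
  rw [mem_closedBall_zero_iff]
  by_contra h
  exact hy (smul_curl_testPotential_eq_zero (not_le.1 h).le)

/-- **`ζ` is smooth.** [folklore] -/
theorem contDiff_testField (hξ : ContDiff ℝ ∞ ξ) (hξc : HasCompactSupport ξ) {n : ℕ∞} :
    ContDiff ℝ n (testField ξ) :=
  (contDiff_curl (contDiff_smul_curl_testPotential hξ hξc)).neg

/-- **`ζ` vanishes off `B̄(0, 7/4)`** (so it is a test field on `B₂`). [folklore] -/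
theorem testField_eq_zero {x : EuclideanSpace ℝ (Fin 3)} (hx : 7 / 4 < ‖x‖) : testField ξ x = 0 := by
  have hx' : x ∉ tsupport (fun y => kwonCutoff y • curl (testPotential ξ) y) := fun h => by
    have := mem_closedBall_zero_iff.1 (tsupport_smul_curl_testPotential_subset h)
    linarith
  rw [testField, curl_eq_zero_of_notMem_tsupport hx', neg_zero]

/-- The topological support of `ζ` lies in `B̄(0, 7/4)`. [folklore] -/
theorem tsupport_testField_subset :
    tsupport (testField ξ) ⊆ closedBall (0 : EuclideanSpace ℝ (Fin 3)) (7 / 4) := by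
  refine closure_minimal (fun y hy => ?_) isClosed_closedBall
  rw [mem_closedBall_zero_iff]
  by_contra h
  exact hy (testField_eq_zero (not_le.1 h))

/-- **`ζ` has compact support.** [folklore] -/
theorem hasCompactSupport_testField : HasCompactSupport (testField ξ) :=
  (isCompact_closedBall (0 : EuclideanSpace ℝ (Fin 3)) (7 / 4)).of_isClosed_subset
    isClosed_closure tsupport_testField_subset

/-- **`div ζ = 0`** (`div curl = 0`). [folklore] -/
theorem divergence_testField (hξ : ContDiff ℝ ∞ ξ) (hξc : HasCompactSupport ξ)
    (x : EuclideanSpace ℝ (Fin 3)) : VectorCalculus.divergence (testField ξ) x = 0 := by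
  have h2 : ContDiff ℝ 2 fun y => kwonCutoff y • curl (testPotential ξ) y :=
    contDiff_smul_curl_testPotential hξ hξc
  have e : testField ξ = fun y => -curl (fun y => kwonCutoff y • curl (testPotential ξ) y) y := rfl
  rw [e]
  simp only [VectorCalculus.divergence, fderiv_fun_neg, ContinuousLinearMap.toLinearMap_neg, map_neg]
  have := divergence_curl_eq_zero_holds _ h2 x
  rw [VectorCalculus.divergence] at this
  rw [this, neg_zero]


/-! ### The expansion of `ζ` -/

/-- The gradient in the standard frame: `∇g(x) = Σᵢ (∂ᵢg)(x) eᵢ`. [folklore] -/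
theorem gradient_eq_sum_fderiv_single (g : EuclideanSpace ℝ (Fin 3) → ℝ)
    (x : EuclideanSpace ℝ (Fin 3)) :
    gradient g x = ∑ i, fderiv ℝ g x (EuclideanSpace.single (i : Fin 3) (1 : ℝ)) •
      EuclideanSpace.single (i : Fin 3) (1 : ℝ) := by
  conv_lhs => rw [← (EuclideanSpace.basisFun (Fin 3) ℝ).sum_repr' (gradient g x)]
  refine Finset.sum_congr rfl fun i _ => ?_
  rw [EuclideanSpace.basisFun_apply, real_inner_comm, inner_gradient_left]

/-- **The expansion of Kwon's test field**: for every `x`,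
`ζ = φ ξ − φ ∇(div A) − ∇φ × curl A` (Leibniz for the curl, `curl curl = ∇div − Δ`, and
`φ ΔA = φ ξ` because `ΔA = ξ` on `B₂ ⊇ supp φ`). [cite: Kwon2023RolePressure, Lemma 2.5 (proof, p. 8)] -/
theorem testField_eq (hξ : ContDiff ℝ ∞ ξ) (hξc : HasCompactSupport ξ)
    (hsupp : tsupport ξ ⊆ ball (0 : EuclideanSpace ℝ (Fin 3)) 1) (x : EuclideanSpace ℝ (Fin 3)) :
    testField ξ x = kwonCutoff x • ξ x
      - kwonCutoff x • gradient (VectorCalculus.divergence (testPotential ξ)) x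
      - cross (gradient kwonCutoff x) (curl (testPotential ξ) x) := by
  have hA : ContDiff ℝ 2 (testPotential ξ) := contDiff_testPotential hξ hξc
  have hcurlA : ContDiff ℝ 1 (curl (testPotential ξ)) :=
    contDiff_curl (contDiff_testPotential hξ hξc)
  have hφd : DifferentiableAt ℝ kwonCutoff x :=
    (contDiff_kwonCutoff (n := 1)).differentiable one_ne_zero x
  have hcd : DifferentiableAt ℝ (curl (testPotential ξ)) x := hcurlA.differentiable one_ne_zero x
  have hΔ : kwonCutoff x • (Δ (testPotential ξ)) x = kwonCutoff x • ξ x := by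
    by_cases hx : ‖x‖ < 2
    · rw [laplacian_testPotential hξ hξc hsupp hx]
    · rw [kwonCutoff, radialCutoff_eq_zero (by norm_num) (by norm_num) (by linarith [not_lt.1 hx]),
        zero_smul, zero_smul]
  rw [testField, curl_smul hφd hcd, fderiv_eq_innerSL_gradient, curlCLM_smulRight_innerSL,
    curl_curl_eq_sum_fderiv_divergence_sub_laplacian hA x, ← gradient_eq_sum_fderiv_single,
    smul_sub, hΔ]
  abel

/-! ### Kernel swap: near the annulus `supp ∇φ`, `A` is the smooth convolution `k ⋆ ξ` -/

/-- **`A = k ⋆ ξ` away from the support of `ξ`**: if `supp ξ ⊆ B̄(0, r)` then for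
`r + 1/4 < |y| < 3 − r` the truncated Newtonian potential of `ξ` is the convolution with the
(smooth) annular kernel. [folklore] -/
theorem testPotential_eq_annularKernel_convolution {r : ℝ}
    (hsupp : tsupport ξ ⊆ closedBall (0 : EuclideanSpace ℝ (Fin 3)) r)
    {y : EuclideanSpace ℝ (Fin 3)} (hy₁ : r + 1 / 4 < ‖y‖) (hy₂ : ‖y‖ < 3 - r) :
    testPotential ξ y = (annularKernel ⋆[lsmul ℝ ℝ, volume] ξ) y := by
  rw [testPotential, convolution_lsmul, convolution_lsmul]
  refine integral_congr_ae (Eventually.of_forall fun z => ?_)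
  by_cases hz : y - z ∈ tsupport ξ
  · have h1 : ‖y - z‖ ≤ r := mem_closedBall_zero_iff.1 (hsupp hz)
    have h2 : ‖y‖ ≤ ‖y - z‖ + ‖z‖ := by
      have := norm_add_le (y - z) z; rwa [sub_add_cancel] at this
    have h3 : ‖z‖ ≤ ‖y‖ + ‖y - z‖ := by
      have := norm_sub_le y (y - z); rwa [sub_sub_cancel] at this
    show testKernel z • ξ (y - z) = annularKernel z • ξ (y - z)
    rw [testKernel_eq_annularKernel (by linarith) (by linarith)]
  · simp only [image_eq_zero_of_notMem_tsupport hz, smul_zero]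

/-- Near every point of the annulus `5/4 ≤ |y| ≤ 7/4` (which carries the densities `u·∇φ`,
`∇φ × u`), `A` agrees with `k ⋆ ξ` on a neighbourhood, for `supp ξ ⊆ B̄(0, r)`, `r < 1`.
[folklore] -/
theorem testPotential_eventuallyEq {r : ℝ} (hr : r < 1)
    (hsupp : tsupport ξ ⊆ closedBall (0 : EuclideanSpace ℝ (Fin 3)) r)
    {y : EuclideanSpace ℝ (Fin 3)} (hy₁ : 5 / 4 ≤ ‖y‖) (hy₂ : ‖y‖ ≤ 7 / 4) :
    testPotential ξ =ᶠ[𝓝 y] (annularKernel ⋆[lsmul ℝ ℝ, volume] ξ) := by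
  have ho : IsOpen {w : EuclideanSpace ℝ (Fin 3) | r + 1 / 4 < ‖w‖ ∧ ‖w‖ < 3 - r} :=
    (isOpen_lt continuous_const continuous_norm).inter (isOpen_lt continuous_norm continuous_const)
  filter_upwards [ho.mem_nhds ⟨by linarith, by linarith⟩] with w hw
  exact testPotential_eq_annularKernel_convolution hsupp hw.1 hw.2

/-- On the annulus the derivative of `A` is that of `k ⋆ ξ`. [folklore] -/
theorem fderiv_testPotential_eq {r : ℝ} (hr : r < 1)
    (hsupp : tsupport ξ ⊆ closedBall (0 : EuclideanSpace ℝ (Fin 3)) r)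
    {y : EuclideanSpace ℝ (Fin 3)} (hy₁ : 5 / 4 ≤ ‖y‖) (hy₂ : ‖y‖ ≤ 7 / 4) :
    fderiv ℝ (testPotential ξ) y = fderiv ℝ (annularKernel ⋆[lsmul ℝ ℝ, volume] ξ) y :=
  (testPotential_eventuallyEq hr hsupp hy₁ hy₂).fderiv_eq

/-- **On the annulus, `div A = div (k ⋆ ξ)`.** [folklore] -/
theorem divergence_testPotential_eq {r : ℝ} (hr : r < 1)
    (hsupp : tsupport ξ ⊆ closedBall (0 : EuclideanSpace ℝ (Fin 3)) r)
    {y : EuclideanSpace ℝ (Fin 3)} (hy₁ : 5 / 4 ≤ ‖y‖) (hy₂ : ‖y‖ ≤ 7 / 4) :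
    VectorCalculus.divergence (testPotential ξ) y =
      VectorCalculus.divergence (annularKernel ⋆[lsmul ℝ ℝ, volume] ξ) y := by
  simp only [VectorCalculus.divergence, fderiv_testPotential_eq hr hsupp hy₁ hy₂]

/-- **On the annulus, `curl A = curl (k ⋆ ξ)`.** [folklore] -/
theorem curl_testPotential_eq {r : ℝ} (hr : r < 1)
    (hsupp : tsupport ξ ⊆ closedBall (0 : EuclideanSpace ℝ (Fin 3)) r)
    {y : EuclideanSpace ℝ (Fin 3)} (hy₁ : 5 / 4 ≤ ‖y‖) (hy₂ : ‖y‖ ≤ 7 / 4) :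
    curl (testPotential ξ) y = curl (annularKernel ⋆[lsmul ℝ ℝ, volume] ξ) y := by
  rw [curl_eq_curlCLM, curl_eq_curlCLM, fderiv_testPotential_eq hr hsupp hy₁ hy₂]

end Kwon2023

end Literature.Analysis.FluidPDE

end
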